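import Literature.AlgebraicGeometry.AbelianVarieties.PoincareSheafUniversalOfNormal
import HarnessLib

/-!
# The universal property of the normalised Poincaré sheaf over ALL bases — statements (M13 programme, node P00)

Layer `Literature/AlgebraicGeometry/Motives` ∩ `AbelianVarieties`, namespace `Literature.AlgebraicGeometry.Motives.AbelianVariety`.
TWO CLOSED `def … : Prop` STATEMENTS, no proof, no instance, no `sorry` (cell `hodgecm-mathlib`, D-0151, programme M13
«the seesaw graph is a closed immersion onto the base», director s131/s140; SPEC = B-p12's signature probe v0.4):

* `U_a3_residual_poincareUniversal` — for a complex abelian variety `A₀`, an ample `Θ`, `Â = A₀/K(Θ)` and any rank-one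
  `𝒫` on `A₀ × Â` with `(1 × φ_Θ)^*𝒫 ≅ Λ(𝒪(Θ))` and `𝒫|_{{0} × Â} ≅ 𝒪`, EVERY rigidified fibrewise-`Pic⁰` line bundle on
  `A₀ × T`, for EVERY `ℂ`-scheme `T`, is `(1 × g)^*𝒫` for a unique `g : T → Â` — ★ `exists_unique_classify_of_normal`
  ([MumfordAV1970] §13 / [MilneAV2008] I §8 over NORMAL bases) with its three hypotheses on `T` deleted, i.e. the `universal`
  field of ★ `AbelianSchemeOver.DualPair` for `(ofAbelianVariety A₀, ofAbelianVariety Â, 𝒫)`; printed for all `T` in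
  [GortzWedhorn2023] (27.41.1) / Def. 27.216 / Thm. 27.198 and [MumfordAV1970] §13 Thm. p. 125.  (Text = B-typ02's HOME sketch
  `U-a3-U-e-signatures` v0.2, token-unchanged.)
* `U_a3_residual_affineFiniteType` — the same over AFFINE bases of FINITE TYPE over `ℂ` (the target of the locality +
  spreading-out reduction, node N0).

The proofs are the business of the sibling files of this directory (`GraphCondition`, `SeesawSheafIffGraphCond`,
`GraphCondInjectivePoints`, the N0/N1/N3/N3d files, `Residual`).  HC_CM is proved only modulo the 7 printed citations until rung 0 closes.

## References
* [MumfordAV1970] D. Mumford, *Abelian Varieties* (1970), §13 (Thm. p. 125 and its proof, pp. 125–130).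
* [GortzWedhorn2023] U. Görtz, T. Wedhorn, *Algebraic Geometry II* (2023), (27.41) eq. (27.41.1), Def. 27.216 (pp. 688–689),
  Thm./Def. 27.198 + Rem. 27.199 (pp. 679–681).
* [MilneAV2008] J. S. Milne, *Abelian Varieties* (2008), I §8 (pp. 36–40).
-/

noncomputable section

open CategoryTheory CategoryTheory.Limits AlgebraicGeometry MonoidalCategory CartesianMonoidalCategory

namespace Literature.AlgebraicGeometry.Motives.AbelianVariety

open Literature.AlgebraicGeometry.AbelianSchemes Literature.AlgebraicGeometry.AbelianVarieties
  Literature.AlgebraicGeometry.Modules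

/-- **U-a3 RESIDUAL (P44)** — the normalised Poincaré sheaf of `(A₀, Θ)` on `A₀ × A₀/K(Θ)` is universal
over EVERY `ℂ`-scheme `T` (★ (R3a) `exists_unique_classify_of_normal` with `[IsIntegral T]`,
`[LocallyOfFiniteType f]`, `hTn` deleted).  Text of B-typ02's HOME sketch v0.2, token-unchanged; proved in `…/PoincareUniversal/Residual.lean`.
[cite: GortzWedhorn2023, (27.41) eq. (27.41.1) and Def. 27.216 (pp. 688–689)] [cite: MumfordAV1970, §13 (Thm. p. 125)] -/
def U_a3_residual_poincareUniversal : Prop :=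
  ∀ (A₀ : AbelianVariety ℂ) (Θ : CartierDivisor A₀.X.left) (hΘ : Θ.IsAmple)
    (P : (A₀.X ⊗ (A₀.dualOf Θ hΘ).X).left.Modules) [P.IsQuasicoherent], HasRank P 1 →
    Nonempty ((Scheme.Modules.pullback (AbelianVariety.Hom.toSchemeHom (A₀.oneProdPhiTheta hΘ))).obj P ≅
      mumfordSheaf A₀ Θ) →
    Nonempty ((Scheme.Modules.pullback (sliceZero A₀ (A₀.dualOf Θ hΘ)).left).obj P ≅
      unitModule (A₀.dualOf Θ hΘ).X.left) →
    ∀ {T : Scheme.{0}} (f : T ⟶ Spec (.of ℂ))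
      (ℒ : (AbelianSchemeOver.ofAbelianVariety A₀).RigidifiedLineBundle f), ℒ.FibrewisePicZero →
      ∃! g : {g : T ⟶ (A₀.dualOf Θ hΘ).X.left // g ≫ (A₀.dualOf Θ hΘ).X.hom = f},
        Nonempty ((Scheme.Modules.pullback ((AbelianSchemeOver.ofAbelianVariety A₀).baseChangeToProd
          (AbelianSchemeOver.ofAbelianVariety (A₀.dualOf Θ hΘ)) f g.1 g.2)).obj P ≅ ℒ.L)

/-- **(M13-0)'s target: the residual over AFFINE bases of FINITE TYPE over `ℂ`** — the same text with
`[IsAffine T] [LocallyOfFiniteType f]` inserted (so `T = Spec R`, `R` a finitely generated `ℂ`-algebra,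
possibly NON-REDUCED: Noetherian, Jacobson). [cite: MumfordAV1970, §13 (Thm. p. 125)] -/
def U_a3_residual_affineFiniteType : Prop :=
  ∀ (A₀ : AbelianVariety ℂ) (Θ : CartierDivisor A₀.X.left) (hΘ : Θ.IsAmple)
    (P : (A₀.X ⊗ (A₀.dualOf Θ hΘ).X).left.Modules) [P.IsQuasicoherent], HasRank P 1 →
    Nonempty ((Scheme.Modules.pullback (AbelianVariety.Hom.toSchemeHom (A₀.oneProdPhiTheta hΘ))).obj P ≅
      mumfordSheaf A₀ Θ) →
    Nonempty ((Scheme.Modules.pullback (sliceZero A₀ (A₀.dualOf Θ hΘ)).left).obj P ≅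
      unitModule (A₀.dualOf Θ hΘ).X.left) →
    ∀ {T : Scheme.{0}} (f : T ⟶ Spec (.of ℂ)) [IsAffine T] [LocallyOfFiniteType f]
      (ℒ : (AbelianSchemeOver.ofAbelianVariety A₀).RigidifiedLineBundle f), ℒ.FibrewisePicZero →
      ∃! g : {g : T ⟶ (A₀.dualOf Θ hΘ).X.left // g ≫ (A₀.dualOf Θ hΘ).X.hom = f},
        Nonempty ((Scheme.Modules.pullback ((AbelianSchemeOver.ofAbelianVariety A₀).baseChangeToProd
          (AbelianSchemeOver.ofAbelianVariety (A₀.dualOf Θ hΘ)) f g.1 g.2)).obj P ≅ ℒ.L)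

end Literature.AlgebraicGeometry.Motives.AbelianVariety

end
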